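import Literature.Analysis.FluidPDE.LerayL3ExistenceFromFiniteEnergy
import Literature.Analysis.FluidPDE.LeraySuitableWeakSolutions
import HarnessLib

/-!
# `leray_solution_exists_of_memLp_three_holds`: every weakly divergence-free `u₀ ∈ L³(ℝ³)` is
# the datum of a global local Leray solution (Rusin–Šverák's `NS(u₀) ≠ ∅`) — discharged

Analysis/FluidPDE glue file (theorems only: no definition, no named fact, no `sorry`)
**discharging the named fact `Literature.Analysis.FluidPDE.leray_solution_exists_of_memLp_three`**
(**E** of `RusinSverakLeraySolutions.lean`; H. Jia, V. Šverák, SIAM J. Math. Anal. 45 (2013) =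
arXiv:1201.1592, §2, Remarks after Def. 1: "The existence of Leray solutions for very general
initial data is proved in [Lemarié-Rieusset 2002]. In our situation with initial data `u₀` in
`L³` we can follow [Calderón, Rusin–Šverák] or see section 4 below"; = Rusin–Šverák 2011 §4 p. 6,
Lemarié-Rieusset 2016 Thm. 14.8 for `L³ ⊂ E²` data).

The proof is the composition of accepted tree theorems:

* `leray_solution_exists_of_memLp_three_of_memLp_two`
  (`LerayL3ExistenceFromFiniteEnergy.lean`: **E** from the existence of global local Leray
  solutions for data in `L² ∩ L³`, through Jia–Šverák's weak `L³` stability theorem **K₃** —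
  `jia_sverak_leray_weak_stability_holds` — and the approximation of divergence-free `L³` fields
  by divergence-free fields in `L² ∩ L³`, `exists_seq_isWeaklyDivFree_memLp_two_three_tendsto`);
* `exists_isGlobalLerayHopf_and_isLocalEnergySolutionOn` (`LeraySuitableWeakSolutions.lean`:
  Leray's weak solutions, with the Riesz pressure, are suitable — Caffarelli–Kohn–Nirenberg 1982,
  Appendix — hence local energy solutions on every strip `ℝ³ × (0, T)` for finite-energy data);
* `exists_isLocalLeraySolution_of_forall_isLocalEnergySolutionOn`
  (`LerayL3ExistenceFromFiniteEnergy.lean`: strips to the global class, by the tower lemma).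

The discharge cannot be appended to `RusinSverakLeraySolutions.lean` itself (import cycle through
`LocalLerayExistence.lean`), hence this sibling file. Axioms: `propext`, `Classical.choice`,
`Quot.sound`.

## Mathlib / tree search

`lean search 'leray_solution_exists_of_memLp_three_holds' --decl`: no declaration before this file
(2026-08-16T00:25Z).

## References

* H. Jia, V. Šverák, SIAM J. Math. Anal. 45 (2013) = arXiv:1201.1592, §2 Def. 1 and Remarks
  (p. 3), §4 proof of Thm. 1 (p. 8). [`JiaSverak2013`]
* W. Rusin, V. Šverák, J. Funct. Anal. 260 (2011) = arXiv:0911.0500, §4 p. 6. [`RusinSverak2011`]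
* P. G. Lemarié-Rieusset, *The Navier–Stokes Problem in the 21st Century* (2016), Thm. 12.2,
  Thm. 13.6, Thm. 14.8, §14.9. [`LemarieRieusset2016`]
* L. Caffarelli, R. Kohn, L. Nirenberg, CPAM 35 (1982), Appendix. [`CaffarelliKohnNirenberg1982`]
-/

noncomputable section

open MeasureTheory

namespace Literature.Analysis.FluidPDE

/-- **Global local Leray solutions for finite-energy data** (Lemarié-Rieusset 2016, §14.9 p. 549:
for `u₀ ∈ L²`, Leray's mollification gives a solution which is suitable — Thm. 12.2, Thm. 13.6 —
i.e. a global local Leray solution, Def. 14.1; Caffarelli–Kohn–Nirenberg 1982, Appendix): every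
weakly divergence-free `a ∈ L²(ℝ³)` is the datum of a global local Leray solution of the
viscosity-`ν` equations, `ν > 0` (Kang–Miura–Tsai Def. 3.2) — Leray's weak solution is a local
energy solution on every strip (`exists_isGlobalLerayHopf_and_isLocalEnergySolutionOn`), hence a
global local Leray solution (`exists_isLocalLeraySolution_of_forall_isLocalEnergySolutionOn`).
[cite: LemarieRieusset2016, §14.9 (PDF p. 549) with Thm. 12.2, Thm. 13.6, Def. 14.1] [cite: CaffarelliKohnNirenberg1982, Appendix] -/
theorem exists_isLocalLeraySolution_of_memLp_two {ν : ℝ} (hν : 0 < ν)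
    {a : EuclideanSpace ℝ (Fin 3) → EuclideanSpace ℝ (Fin 3)} (ha : MemLp a 2 volume)
    (hdiv : IsWeaklyDivFree a) :
    ∃ (v : ℝ → EuclideanSpace ℝ (Fin 3) → EuclideanSpace ℝ (Fin 3))
      (π : ℝ → EuclideanSpace ℝ (Fin 3) → ℝ), IsLocalLeraySolution ν a v π := by
  obtain ⟨u, p, -, -, -, -, -, -, hloc⟩ := exists_isGlobalLerayHopf_and_isLocalEnergySolutionOn hν ha hdiv
  obtain ⟨v, π, hvπ, -⟩ := exists_isLocalLeraySolution_of_forall_isLocalEnergySolutionOn hloc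
  exact ⟨v, π, hvπ⟩

/-- **E, discharged**: every weakly divergence-free `u₀ ∈ L³(ℝ³)` is the datum of a global local
Leray solution of the unit-viscosity Navier–Stokes equations (`IsLocalLeraySolution 1 u₀ u p`,
Kang–Miura–Tsai Def. 3.2 = Jia–Šverák's `𝒩(u₀)` = Rusin–Šverák's `NS(u₀)`) — Jia–Šverák 2013,
§2 Remarks after Def. 1 with §4 (the solution for `L³` data as a limit of solutions with
finite-energy data, `leray_solution_exists_of_memLp_three_of_memLp_two`), the finite-energy
solutions being Leray's weak solutions, which are suitable (Caffarelli–Kohn–Nirenberg 1982,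
Appendix; `exists_isLocalLeraySolution_of_memLp_two`).
[cite: JiaSverak2013, §2 Remarks after Def. 1 (arXiv:1201.1592 p. 3) and §4 proof of Thm. 1 (p. 8)] [cite: CaffarelliKohnNirenberg1982, Appendix] -/
theorem leray_solution_exists_of_memLp_three_holds : leray_solution_exists_of_memLp_three :=
  leray_solution_exists_of_memLp_three_of_memLp_two fun _ ha2 _ hdiv =>
    exists_isLocalLeraySolution_of_memLp_two one_pos ha2 hdiv

end Literature.Analysis.FluidPDE
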